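import Summits.RiemannHypothesis.RiemannHypothesis.Theorems.WeilBochnerMeasureCountingCharPrelim
import HarnessLib

/-!
# RiemannHypothesis (GRH arm) — the counting law of a `χ`-window measure, even characters

Helper file (`--supports stmt-RiemannHypothesis-0098`), GRH-free, standard axioms.  Seat rh-explicit
weil-3 (structure), gen6.  The `χ`-twin of `WeilBochnerMeasureCounting.lean` for EVEN characters of
modulus `q ≠ 1` (Weil side and reflection: `WeilBochnerMeasureCountingCharPrelim.lean`).

Let `μ` be ANY positive measure representing Weil's form `W_χ`
(`Literature.NumberTheory.LFunctions.weilFunctionalChar`) on the window `[-b, b]`, `b > 0`, i.e.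
`Q_χ(g) = ∫ ‖ĝ(½+it)‖² dμ` for every test `g` supported in `[-b, b]` (such `μ` exist iff the rung
`WeilPositivityOnChar χ b` holds, `WeilBochnerChar.weilPositivityOnChar_iff_exists_measure`; under
GRH for `χ` the zeros of `L(s, χ)` serve).  If `χ` is EVEN (`charParity χ = 0`) and `q ≠ 1` then

  `|μ[0, T] − (θ(T)/π + (T/2π) log q)| ≤ C (1 + log(1 + T))`   for all `T ≥ 0`

(`abs_measureReal_Icc_zero_sub_le_char`, `θ = riemannSiegelTheta`), the same on `[-T, 0]`
(`abs_measureReal_Icc_sub_le_char`, via the reflected measure, which represents the even character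
`χ⁻¹`), and `|μ[-T, T] − 2θ(T)/π − (T/π) log q| ≤ C (1 + log(1 + T))`
(`abs_measureReal_Icc_symm_sub_le_char`): every such measure has the Riemann–von Mangoldt counting
function of `L(s, χ)`, `(T/π) log(qT/2πe) + O(log T)` below height `T` — the conductor enters exactly
as the density shift `(1/π) log q`.  Proof: Selberg kernels, the `χ` kernel lemma
`weilFunctionalChar_kernel_eq_integral` and the minorant-by-additivity trick, verbatim as for `ζ`.

Not here: ODD characters (archimedean weight `Re ψ(¾ + it/2)`; TODO).
-/

noncomputable section

set_option linter.dupNamespace false  -- the mandated namespace repeats `RiemannHypothesis`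

open Complex Filter Set MeasureTheory
open scoped Real Topology ContDiff ComplexConjugate
open Literature.NumberTheory.LFunctions Literature.Analysis.Fourier Literature.Analysis.SpecialFunctions
open Summit.RiemannHypothesis.RiemannHypothesis.Theorems.WeilBochnerMeasure

namespace Summit.RiemannHypothesis.RiemannHypothesis.Theorems.WeilBochnerMeasureChar

variable {q : ℕ} (χ : DirichletCharacter ℂ q) {b : ℝ} {μ : Measure ℝ}
/-! ## The counting law on `[0, T]` -/

/-- **Core of the `χ` counting law on `[0, T]`** (even `χ`, `q ≠ 1`).  If `μ` represents `W_χ` on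
`[-b, b]` (`b > 0`) then there is `C` with `μ[0, T] < ∞` and
`|μ[0, T] − θ(T)/π − (T/2π) log q| ≤ C (1 + log(1 + T))` for all `T ≥ 0`. -/
theorem abs_measureReal_Icc_zero_sub_le_char (hq : q ≠ 1) (hχ : charParity χ = 0) (hb : 0 < b)
    (hμ : ∀ g : ℝ → ℂ, IsWeilTest g → tsupport g ⊆ Icc (-b) b →
      Integrable (fun t : ℝ ↦ ‖weilMellin g (1 / 2 + t * I)‖ ^ 2) μ ∧
        weilQuadraticChar χ g = ((∫ t, ‖weilMellin g (1 / 2 + t * I)‖ ^ 2 ∂μ : ℝ) : ℂ)) :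
    ∃ C : ℝ, ∀ T : ℝ, 0 ≤ T → μ (Icc 0 T) < ⊤ ∧
      |μ.real (Icc 0 T) - (riemannSiegelTheta T / π + T / (2 * π) * Real.log q)| ≤
        C * (1 + Real.log (1 + T)) := by
  -- bandwidth `2πΔ = c = min b (log 2)`
  set c : ℝ := min b (Real.log 2) with hc
  have hc0 : 0 < c := lt_min hb (Real.log_pos one_lt_two)
  have hcb : c ≤ b := min_le_left _ _
  have hc2 : c ≤ Real.log 2 := min_le_right _ _
  have hclt : c < 2 * b := by linarith
  set Δ : ℝ := c / (2 * π) with hΔ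
  have hΔ0 : 0 < Δ := by positivity
  have h2πΔ : 2 * π * Δ = c := by
    rw [hΔ]; field_simp
  obtain ⟨A, B, hAB⟩ := exists_weil_side_bound_char χ hq hχ hΔ0 (by rw [h2πΔ]; exact hc2)
  refine ⟨max A B, fun T hT ↦ ?_⟩
  obtain ⟨gp, gm, hgpc, hgmc, hgps, hgms, hgpM, hgmM, hgp0, hgm0⟩ := exists_selberg_kernels hΔ0 hT
  -- Weil side
  have hp := hAB T hT gp hgpc hgps (Or.inl ⟨hgpM, hgp0⟩)
  have hm := hAB T hT gm hgmc hgms (Or.inr ⟨hgmM, hgm0⟩)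
  rw [h2πΔ] at hgps hgms
  have hgps' : tsupport gp ⊆ Icc (-Real.log 2) (Real.log 2) :=
    hgps.trans (Icc_subset_Icc (by linarith) hc2)
  have hgms' : tsupport gm ⊆ Icc (-Real.log 2) (Real.log 2) :=
    hgms.trans (Icc_subset_Icc (by linarith) hc2)
  -- real transforms on the line
  set Fp : ℝ → ℝ := selbergMajorantReal Δ 0 T with hFp
  set Fm : ℝ → ℝ := selbergMinorantReal Δ 0 T with hFm
  have hgp_line : ∀ u : ℝ, weilMellin gp (1 / 2 + u * I) = (Fp u : ℂ) := fun u ↦ by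
    rw [hgpM, selbergMajorant_ofReal]
  have hgm_line : ∀ u : ℝ, weilMellin gm (1 / 2 + u * I) = (Fm u : ℂ) := fun u ↦ by
    rw [hgmM, selbergMinorant_ofReal]
  have hgpcs : HasCompactSupport gp := isCompact_Icc.of_isClosed_subset (isClosed_tsupport _) hgps
  have hgmcs : HasCompactSupport gm := isCompact_Icc.of_isClosed_subset (isClosed_tsupport _) hgms
  -- quadratic decay of the transforms
  obtain ⟨Kp, hKp0, hKp⟩ := exists_norm_selbergMajorant_le hΔ0 0 T
  obtain ⟨Km, hKm0, hKm⟩ := exists_norm_selbergMinorant_le hΔ0 0 T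
  have hdecp : ∀ u : ℝ, ‖weilMellin gp (1 / 2 + u * I)‖ ≤ Kp * (1 + 2 * (1 + T ^ 2)) / (1 + u ^ 2) :=
    fun u ↦ by
      rw [hgpM]
      have h := hKp u
      simp only [Complex.ofReal_im, abs_zero, mul_zero, Real.exp_zero, mul_one, Complex.ofReal_re] at h
      exact h.trans (profile_le_div hKp0.le)
  have hdecm : ∀ u : ℝ, ‖weilMellin gm (1 / 2 + u * I)‖ ≤ Km * (1 + 2 * (1 + T ^ 2)) / (1 + u ^ 2) :=
    fun u ↦ by
      rw [hgmM]
      have h := hKm u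
      simp only [Complex.ofReal_im, abs_zero, mul_zero, Real.exp_zero, mul_one, Complex.ofReal_re] at h
      exact h.trans (profile_le_div hKm0.le)
  -- the difference kernel `hd = gp - gm`, transform `Fp - Fm ≥ 0`
  set hd : ℝ → ℂ := fun x ↦ gp x - gm x with hhd
  have hhdc : Continuous hd := hgpc.sub hgmc
  have hhds : tsupport hd ⊆ Icc (-c) c := by
    refine closure_minimal (fun x hx ↦ ?_) isClosed_Icc
    rw [Function.mem_support] at hx
    by_contra hxc
    have h1 : gp x = 0 := image_eq_zero_of_notMem_tsupport fun h ↦ hxc (hgps h)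
    have h2 : gm x = 0 := image_eq_zero_of_notMem_tsupport fun h ↦ hxc (hgms h)
    exact hx (by simp only [hhd, h1, h2, sub_zero])
  have hhds' : tsupport hd ⊆ Icc (-Real.log 2) (Real.log 2) :=
    hhds.trans (Icc_subset_Icc (by linarith) hc2)
  have hhdcs : HasCompactSupport hd := isCompact_Icc.of_isClosed_subset (isClosed_tsupport _) hhds
  have hsum : gm + hd = gp := by
    funext x; simp only [Pi.add_apply, hhd]; ring
  have hhd_line : ∀ u : ℝ, weilMellin hd (1 / 2 + u * I) = ((Fp u - Fm u : ℝ) : ℂ) := by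
    intro u
    have h := weilMellin_add hgmc hgmcs hhdc hhdcs (1 / 2 + u * I)
    rw [hsum, hgp_line, hgm_line] at h
    push_cast
    linear_combination -h
  have hdech : ∀ u : ℝ, ‖weilMellin hd (1 / 2 + u * I)‖ ≤
      (Kp + Km) * (1 + 2 * (1 + T ^ 2)) / (1 + u ^ 2) := by
    intro u
    have e : weilMellin hd (1 / 2 + u * I) =
        weilMellin gp (1 / 2 + u * I) - weilMellin gm (1 / 2 + u * I) := by
      rw [hhd_line, hgp_line, hgm_line]; push_cast; ring
    rw [e]
    calc ‖weilMellin gp (1 / 2 + u * I) - weilMellin gm (1 / 2 + u * I)‖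
        ≤ ‖weilMellin gp (1 / 2 + u * I)‖ + ‖weilMellin gm (1 / 2 + u * I)‖ := norm_sub_le _ _
      _ ≤ Kp * (1 + 2 * (1 + T ^ 2)) / (1 + u ^ 2) + Km * (1 + 2 * (1 + T ^ 2)) / (1 + u ^ 2) :=
          add_le_add (hdecp u) (hdecm u)
      _ = (Kp + Km) * (1 + 2 * (1 + T ^ 2)) / (1 + u ^ 2) := by ring
  -- signs: `Fm ≤ 𝟙_{[0,T]} ≤ Fp`
  set ind : ℝ → ℝ := (Icc 0 T).indicator (fun _ ↦ (1 : ℝ)) with hind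
  have hind_le : ∀ u, ind u ≤ Fp u := fun u ↦ indicator_le_selbergMajorantReal hΔ0 hT u
  have hle_ind : ∀ u, Fm u ≤ ind u := fun u ↦ selbergMinorantReal_le_indicator_Icc hΔ0 0 T u
  have hind0 : ∀ u, 0 ≤ ind u := fun u ↦ Set.indicator_nonneg (fun _ _ ↦ zero_le_one) u
  have hFp0 : ∀ u, 0 ≤ Fp u := fun u ↦ (hind0 u).trans (hind_le u)
  have hFpm0 : ∀ u, 0 ≤ Fp u - Fm u := fun u ↦ by linarith [hind_le u, hle_ind u]
  -- measure side: `∫ Fp dμ = W_χ(gp)`, `∫ (Fp - Fm) dμ = W_χ(hd)`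
  obtain ⟨hIp, hWp⟩ := weilFunctionalChar_kernel_eq_integral χ hb hμ hgpc hclt hgps hdecp
    (fun u ↦ by rw [hgp_line]; exact ⟨Complex.ofReal_im _, by rw [Complex.ofReal_re]; exact hFp0 u⟩)
  obtain ⟨hId, hWd⟩ := weilFunctionalChar_kernel_eq_integral χ hb hμ hhdc hclt hhds hdech
    (fun u ↦ by rw [hhd_line]; exact ⟨Complex.ofReal_im _, by rw [Complex.ofReal_re]; exact hFpm0 u⟩)
  simp only [hgp_line, Complex.ofReal_re] at hIp hWp
  simp only [hhd_line, Complex.ofReal_re] at hId hWd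
  -- `W_χ(gp) = W_χ(gm) + W_χ(hd)`, hence `Re W_χ(gm) = ∫ Fm dμ`
  have hAm := integrable_arch_of_decay hgmc hgmcs hdecm
  have hAd := integrable_arch_of_decay hhdc hhdcs hdech
  have hWadd : weilFunctionalChar χ gp = weilFunctionalChar χ gm + weilFunctionalChar χ hd := by
    rw [← hsum]
    exact weilFunctionalChar_add_of_even_firstWindow χ hq hχ hgmc hgms' hhdc hhds' hAm hAd
  have hIm : Integrable Fm μ :=
    (hIp.sub hId).congr (ae_of_all _ fun t ↦ by simp only [Pi.sub_apply]; ring)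
  have hWm_re : (weilFunctionalChar χ gm).re = ∫ t, Fm t ∂μ := by
    have h : weilFunctionalChar χ gm = weilFunctionalChar χ gp - weilFunctionalChar χ hd := by
      rw [hWadd]; ring
    rw [h, hWp, hWd, ← Complex.ofReal_sub, Complex.ofReal_re, ← integral_sub hIp hId]
    exact integral_congr_ae (ae_of_all _ fun t ↦ by ring)
  have hWp_re : (weilFunctionalChar χ gp).re = ∫ t, Fp t ∂μ := by rw [hWp, Complex.ofReal_re]
  -- the indicator is integrable and integrates to `μ[0, T]`
  have hindm : AEStronglyMeasurable ind μ :=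
    (measurable_const.indicator measurableSet_Icc).aestronglyMeasurable
  have hindi : Integrable ind μ := hIp.mono' hindm (ae_of_all _ fun t ↦ by
    rw [Real.norm_eq_abs, abs_of_nonneg (hind0 t)]; exact hind_le t)
  have hindint : ∫ t, ind t ∂μ = μ.real (Icc 0 T) := integral_indicator_one measurableSet_Icc
  have hfin : μ (Icc 0 T) < ⊤ := by
    refine lt_of_le_of_lt (measure_mono fun t ht ↦ ?_) (hIp.measure_norm_ge_lt_top zero_lt_one)
    have h := hind_le t
    simp only [hind, indicator_of_mem ht] at h
    show (1 : ℝ) ≤ ‖Fp t‖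
    rw [Real.norm_eq_abs, abs_of_nonneg (hFp0 t)]
    exact h
  -- squeeze
  have hup : μ.real (Icc 0 T) ≤ (weilFunctionalChar χ gp).re := by
    rw [hWp_re, ← hindint]; exact integral_mono hindi hIp hind_le
  have hlow : (weilFunctionalChar χ gm).re ≤ μ.real (Icc 0 T) := by
    rw [hWm_re, ← hindint]; exact integral_mono hIm hindi hle_ind
  refine ⟨hfin, ?_⟩
  have hlogT : 0 ≤ Real.log (1 + T) := Real.log_nonneg (by linarith)
  have hA : A ≤ max A B := le_max_left _ _
  have hB : B * Real.log (1 + T) ≤ max A B * Real.log (1 + T) :=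
    mul_le_mul_of_nonneg_right (le_max_right _ _) hlogT
  rw [abs_le] at hp hm ⊢
  constructor <;> nlinarith [hp.1, hp.2, hm.1, hm.2]

/-! ## The counting law on both half-lines -/

/-- **The Riemann–von Mangoldt counting law of a `χ`-window measure (even `χ` mod `q ≠ 1`), both
half-lines.**  If `μ` represents `W_χ` on `[-b, b]` (`b > 0`), there is `C` such that for all `T ≥ 0`
`|μ[0, T] − θ(T)/π − (T/2π) log q| ≤ C (1 + log(1 + T))` and
`|μ[-T, 0] − θ(T)/π − (T/2π) log q| ≤ C (1 + log(1 + T))` (the second is the first for the reflected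
measure, which represents the even character `χ⁻¹` of the same modulus). -/
theorem abs_measureReal_Icc_sub_le_char [NeZero q] (hq : q ≠ 1) (hχ : charParity χ = 0)
    (hb : 0 < b)
    (hμ : ∀ g : ℝ → ℂ, IsWeilTest g → tsupport g ⊆ Icc (-b) b →
      Integrable (fun t : ℝ ↦ ‖weilMellin g (1 / 2 + t * I)‖ ^ 2) μ ∧
        weilQuadraticChar χ g = ((∫ t, ‖weilMellin g (1 / 2 + t * I)‖ ^ 2 ∂μ : ℝ) : ℂ)) :
    ∃ C : ℝ, ∀ T : ℝ, 0 ≤ T →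
      |μ.real (Icc 0 T) - (riemannSiegelTheta T / π + T / (2 * π) * Real.log q)| ≤
          C * (1 + Real.log (1 + T)) ∧
        |μ.real (Icc (-T) 0) - (riemannSiegelTheta T / π + T / (2 * π) * Real.log q)| ≤
          C * (1 + Real.log (1 + T)) := by
  obtain ⟨C₁, hC₁⟩ := abs_measureReal_Icc_zero_sub_le_char χ hq hχ hb hμ
  have hχ' : charParity χ⁻¹ = 0 := by rw [charParity_inv]; exact hχ
  obtain ⟨C₂, hC₂⟩ :=
    abs_measureReal_Icc_zero_sub_le_char χ⁻¹ hq hχ' hb (represents_map_neg_char χ hμ)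
  refine ⟨max C₁ C₂, fun T hT ↦ ⟨?_, ?_⟩⟩
  · have h := (hC₁ T hT).2
    have hlog : 0 ≤ 1 + Real.log (1 + T) := by
      have := Real.log_nonneg (by linarith : (1 : ℝ) ≤ 1 + T); linarith
    exact h.trans (mul_le_mul_of_nonneg_right (le_max_left _ _) hlog)
  · have h := (hC₂ T hT).2
    rw [map_neg_measureReal_Icc] at h
    have hlog : 0 ≤ 1 + Real.log (1 + T) := by
      have := Real.log_nonneg (by linarith : (1 : ℝ) ≤ 1 + T); linarith
    exact h.trans (mul_le_mul_of_nonneg_right (le_max_right _ _) hlog)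

/-- **Symmetric form**: `|μ[-T, T] − 2θ(T)/π − (T/π) log q| ≤ C (1 + log(1 + T))` for every measure
representing `W_χ` on a window (even `χ` mod `q ≠ 1`): the measure has `(T/π) log(qT/2πe) + O(log qT)`
mass below height `T`, the density of zeros of `L(s, χ)`. -/
theorem abs_measureReal_Icc_symm_sub_le_char [NeZero q] (hq : q ≠ 1) (hχ : charParity χ = 0)
    (hb : 0 < b)
    (hμ : ∀ g : ℝ → ℂ, IsWeilTest g → tsupport g ⊆ Icc (-b) b →
      Integrable (fun t : ℝ ↦ ‖weilMellin g (1 / 2 + t * I)‖ ^ 2) μ ∧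
        weilQuadraticChar χ g = ((∫ t, ‖weilMellin g (1 / 2 + t * I)‖ ^ 2 ∂μ : ℝ) : ℂ)) :
    ∃ C : ℝ, ∀ T : ℝ, 0 ≤ T →
      |μ.real (Icc (-T) T) - (2 * riemannSiegelTheta T / π + T / π * Real.log q)| ≤
        C * (1 + Real.log (1 + T)) := by
  obtain ⟨C, hC⟩ := abs_measureReal_Icc_sub_le_char χ hq hχ hb hμ
  obtain ⟨C₀, hC₀⟩ := abs_measureReal_Icc_zero_sub_le_char χ hq hχ hb hμ
  -- `μ{0} ≤ μ[0,0]` is finite and enters once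
  refine ⟨2 * C + μ.real (Icc 0 0), fun T hT ↦ ?_⟩
  obtain ⟨h1, h2⟩ := hC T hT
  have hfinT : μ (Icc 0 T) < ⊤ := (hC₀ T hT).1
  have hfin0 : μ (Icc 0 0) < ⊤ := (hC₀ 0 le_rfl).1
  have hfinN : μ (Icc (-T) 0) < ⊤ := by
    have := (abs_measureReal_Icc_zero_sub_le_char χ⁻¹ hq (by rw [charParity_inv]; exact hχ) hb
      (represents_map_neg_char χ hμ))
    obtain ⟨C', hC'⟩ := this
    have h := (hC' T hT).1
    rwa [Measure.map_apply measurable_neg measurableSet_Icc, show (fun t : ℝ ↦ -t) ⁻¹' Icc 0 T =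
      Icc (-T) 0 by ext t; simp only [mem_preimage, mem_Icc]; constructor <;> intro h' <;>
        constructor <;> linarith [h'.1, h'.2]] at h
  -- inclusion–exclusion: `μ[-T,T] = μ[-T,0] + μ[0,T] − μ{0}`… as an inequality pair
  have hunion : Icc (-T) T = Icc (-T) 0 ∪ Icc 0 T := by
    rw [Icc_union_Icc_eq_Icc (by linarith) hT]
  have hle : μ.real (Icc (-T) T) ≤ μ.real (Icc (-T) 0) + μ.real (Icc 0 T) := by
    rw [hunion]; exact measureReal_union_le _ _
  have hge : μ.real (Icc (-T) 0) + μ.real (Icc 0 T) ≤ μ.real (Icc (-T) T) + μ.real (Icc 0 0) := by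
    have hinter : Icc (-T) 0 ∩ Icc 0 T = Icc 0 0 := by
      ext t; simp only [mem_inter_iff, mem_Icc]; constructor
      · rintro ⟨⟨-, h0⟩, ⟨h0', -⟩⟩; exact ⟨h0', h0⟩
      · rintro ⟨h0, h0'⟩; exact ⟨⟨by linarith, h0'⟩, ⟨h0, by linarith⟩⟩
    have h := measureReal_union_add_inter (μ := μ) measurableSet_Icc (s := Icc (-T) 0) (t := Icc 0 T)
      (ne_of_lt hfinN)
    rw [← hunion, hinter] at h
    linarith
  have hlog0 : 0 ≤ Real.log (1 + T) := Real.log_nonneg (by linarith : (1 : ℝ) ≤ 1 + T)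
  have h00 : 0 ≤ μ.real (Icc 0 0) := measureReal_nonneg
  have hx : 0 ≤ μ.real (Icc 0 0) * Real.log (1 + T) := mul_nonneg h00 hlog0
  have e : T / π * Real.log q = 2 * (T / (2 * π) * Real.log q) := by
    field_simp
  have e2 : 2 * riemannSiegelTheta T / π = 2 * (riemannSiegelTheta T / π) := by ring
  have e3 : (2 * C + μ.real (Icc 0 0)) * (1 + Real.log (1 + T)) =
      2 * (C * (1 + Real.log (1 + T))) + μ.real (Icc 0 0) + μ.real (Icc 0 0) * Real.log (1 + T) := by
    ring
  rw [e, e2, e3, abs_le]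
  rw [abs_le] at h1 h2
  obtain ⟨h1a, h1b⟩ := h1
  obtain ⟨h2a, h2b⟩ := h2
  constructor <;> linarith
end Summit.RiemannHypothesis.RiemannHypothesis.Theorems.WeilBochnerMeasureChar

end
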